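import Literature.NumberTheory.ComplexMultiplication.MainTheoremOfComplexMultiplication
import Literature.FieldTheory.AlgClosed.AutomorphismExtension
import HarnessLib

/-!
# Algebra of «`σ = [s, M]` on `M_ab`»: existence, products, inverses, independence of the embedding
# (Shimura 1998, §18.3 p. 122; §21.4, proof of Thm. 21.4, pp. 147–148)

`IsArtinLift M s σ` (`Motives/…/MainTheoremOfComplexMultiplication`, B-typ02 p589933) says that the
automorphism `σ ∈ Aut(ℂ/M)` restricts, along SOME `M`-embedding `e : M̄ → ℂ`, to a `γ ∈ Gal(M̄/M)` whose
class in `Gal(M^ab/M)` is the Artin symbol `[s, M]` of the idèle `s` (arithmetic normalisation, the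
tree's `NumberFields.ideleArtinMap`).  Shimura's proof of Thm. 21.4 (pp. 147–148) uses this relation as a
piece of ALGEBRA: «For every `σ ∈ Gal(ℚ̄/k)` take `y ∈ k_𝐀^×` so that `σ = [y, k]` on `k_ab`» (existence),
«`c` is uniquely determined by `σ` independently of the choice of `y`» (two lifts of one `σ` have the
same Artin symbol, i.e. differ by the kernel), «`c_{στ} = c_σ c_τ` and `λ_{στ} = λ_σ^τ λ_τ`» (the product
of lifts lifts the product).  This file proves exactly these facts, all from Mathlib's
`AlgEquiv.restrictNormal` / `AlgHom.restrictNormal'` (restriction of automorphisms and embeddings to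
the normal extension `M̄/M`) and the SURJECTIVITY of the Artin map (`NumberFields.ideleArtinMap_surjective`,
class field theory, PROVED in the tree):

* `exists_absoluteGaloisGroup_restrict` — `σ ∈ Aut(ℂ/M)` restricts along any `e : M̄ →ₐ[M] ℂ`;
* `exists_absoluteGaloisGroup_comp_eq` — two `M`-embeddings `M̄ → ℂ` differ by an element of `Gal(M̄/M)`;
* `exists_isArtinLift` — **every `σ ∈ Aut(ℂ/M)` has an Artin lift `s`** («take `y` so that `σ = [y,k]`»);
* `IsArtinLift.exists_of_embedding` — the witness `γ` may be taken along ANY prescribed embedding `e`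
  (conjugate the given witness; the Artin symbol lives in the abelianisation);
* `IsArtinLift.mul`, `IsArtinLift.inv`, `IsArtinLift.of_ideleArtinMap_eq` — products, inverses, and
  dependence on `[s, M]` only;
* `IsArtinLift.ideleArtinMap_eq` — **two lifts of the same `σ` have the same Artin symbol**
  («independently of the choice of `y`»), `IsArtinLift.ideleArtinMap_inv_mul_eq_one`.

Everything is proved; no definition, no named fact.

## References

* [Shimura1998] G. Shimura, *Abelian Varieties with Complex Multiplication and Modular Functions* (1998),
  §18.3 p. 122 («[a, M]», «a canonical homomorphism of M_𝐀^× onto Gal(M_ab/M)»), §21.4, proof of Thm. 21.4, pp. 147–148.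
* [Neukirch2013] J. Neukirch, *Algebraic Number Theory*, Ch. IV §1 (the absolute Galois group), VI (6.1).
-/

noncomputable section

open scoped NumberField

namespace Literature.NumberTheory.ComplexMultiplication

open Literature.NumberTheory.GaloisRepresentations (ideleGroup absGaloisAbProj)
open Literature.NumberTheory.NumberFields (ideleArtinMap ideleArtinMap_surjective)
open Field (absoluteGaloisGroup)
open Field.absoluteGaloisGroup (toAlgEquiv)

variable {M : Type} [Field M] [NumberField M] [Algebra M ℂ]

/-! ### Restricting automorphisms of `ℂ` and comparing embeddings `M̄ → ℂ` -/

/-- **Every `σ ∈ Aut(ℂ/M)` restricts to `Gal(M̄/M)` along any `M`-embedding `e : M̄ → ℂ`**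
(`e(M̄)` is the algebraic closure of `M` in `ℂ`, stable under `σ`; Mathlib `AlgEquiv.restrictNormal`).
[cite: Neukirch2013, Ch. IV §1] -/
theorem exists_absoluteGaloisGroup_restrict (e : AlgebraicClosure M →ₐ[M] ℂ) (σ : ℂ ≃ₐ[M] ℂ) :
    ∃ γ : absoluteGaloisGroup M, ∀ x : AlgebraicClosure M, e (toAlgEquiv M γ x) = σ (e x) := by
  letI : Algebra (AlgebraicClosure M) ℂ := e.toRingHom.toAlgebra
  haveI : IsScalarTower M (AlgebraicClosure M) ℂ :=
    IsScalarTower.of_algebraMap_eq fun x ↦ (e.commutes x).symm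
  refine ⟨(toAlgEquiv M).symm (σ.restrictNormal (AlgebraicClosure M)), fun x ↦ ?_⟩
  rw [MulEquiv.apply_symm_apply]
  exact AlgEquiv.restrictNormal_commutes σ (AlgebraicClosure M) x

/-- **Two `M`-embeddings `e, e′ : M̄ → ℂ` differ by an element of `Gal(M̄/M)`**: `e ∘ δ = e′` for some `δ`
(`M̄/M` is normal; Mathlib `AlgHom.restrictNormal'`). [cite: Neukirch2013, Ch. IV §1] -/
theorem exists_absoluteGaloisGroup_comp_eq (e e' : AlgebraicClosure M →ₐ[M] ℂ) :
    ∃ δ : absoluteGaloisGroup M, ∀ x : AlgebraicClosure M, e (toAlgEquiv M δ x) = e' x := by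
  letI : Algebra (AlgebraicClosure M) ℂ := e.toRingHom.toAlgebra
  haveI : IsScalarTower M (AlgebraicClosure M) ℂ :=
    IsScalarTower.of_algebraMap_eq fun x ↦ (e.commutes x).symm
  refine ⟨(toAlgEquiv M).symm (e'.restrictNormal' (AlgebraicClosure M)), fun x ↦ ?_⟩
  rw [MulEquiv.apply_symm_apply]
  exact AlgHom.restrictNormal_commutes e' (AlgebraicClosure M) x

/-! ### Existence of Artin lifts -/

variable (M) in
/-- **Every `σ ∈ Aut(ℂ/M)` is `[s, M]` on `M_ab` for some idèle `s`** («For every `σ` take `y ∈ k_𝐀^×`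
so that `σ = [y, k]` on `k_ab`», Shimura pp. 147–148): restrict `σ` to `Gal(M̄/M)` along an embedding and
lift its abelianised class through the SURJECTIVE Artin map (`NumberFields.ideleArtinMap_surjective`).
[cite: Shimura1998, §21.4, proof of Thm. 21.4, pp. 147–148 and §18.3 p. 122] -/
theorem exists_isArtinLift (σ : ℂ ≃ₐ[M] ℂ) : ∃ s : ideleGroup M, IsArtinLift M s σ := by
  let e : AlgebraicClosure M →ₐ[M] ℂ := IsAlgClosed.lift
  obtain ⟨γ, hγ⟩ := exists_absoluteGaloisGroup_restrict e σ
  obtain ⟨s, hs⟩ := ideleArtinMap_surjective M (absGaloisAbProj M γ)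
  exact ⟨s, e, γ, hγ, hs.symm⟩

/-! ### Changing the embedding; products and inverses -/

variable {s t : ideleGroup M} {σ τ : ℂ ≃ₐ[M] ℂ}

/-- **The witness of «`σ = [s, M]`» may be taken along any prescribed embedding `e : M̄ → ℂ`**: two
embeddings differ by `δ ∈ Gal(M̄/M)`, conjugating the witness by `δ` does not change its class in the
abelianisation `Gal(M^ab/M)`. [cite: Shimura1998, §18.3 p. 122] [cite: Neukirch2013, Ch. IV §1] -/
theorem IsArtinLift.exists_of_embedding (h : IsArtinLift M s σ) (e : AlgebraicClosure M →ₐ[M] ℂ) :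
    ∃ γ : absoluteGaloisGroup M,
      (∀ x : AlgebraicClosure M, e (toAlgEquiv M γ x) = σ (e x)) ∧ absGaloisAbProj M γ = ideleArtinMap M s := by
  obtain ⟨e', γ', he', hγ'⟩ := h
  obtain ⟨δ, hδ⟩ := exists_absoluteGaloisGroup_comp_eq e e'
  refine ⟨δ * γ' * δ⁻¹, fun x ↦ ?_, ?_⟩
  · have hx : e' (toAlgEquiv M δ⁻¹ x) = e x := by
      rw [← hδ, ← AlgEquiv.mul_apply, ← map_mul, mul_inv_cancel, map_one, AlgEquiv.one_apply]
    rw [map_mul, map_mul, AlgEquiv.mul_apply, AlgEquiv.mul_apply, hδ, he', hx]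
  · rw [map_mul, map_mul, hγ', map_inv, mul_inv_cancel_comm]

/-- **Products of lifts lift products**: if `σ = [s, M]` and `τ = [t, M]` on `M_ab` then
`στ = [st, M]` on `M_ab` («`c_{στ} = c_σ c_τ`», Shimura pp. 147–148; `[·, M]` is a homomorphism).
[cite: Shimura1998, §21.4, proof of Thm. 21.4, pp. 147–148] -/
theorem IsArtinLift.mul (h₁ : IsArtinLift M s σ) (h₂ : IsArtinLift M t τ) :
    IsArtinLift M (s * t) (σ * τ) := by
  obtain ⟨e, γ, he, hγ⟩ := h₁
  obtain ⟨γ', he', hγ'⟩ := h₂.exists_of_embedding e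
  refine ⟨e, γ * γ', fun x ↦ ?_, ?_⟩
  · rw [map_mul, AlgEquiv.mul_apply, he, he', AlgEquiv.mul_apply]
  · rw [map_mul, map_mul, hγ, hγ']

/-- **Inverses**: if `σ = [s, M]` on `M_ab` then `σ⁻¹ = [s⁻¹, M]`. [cite: Shimura1998, §18.3 p. 122] -/
theorem IsArtinLift.inv (h : IsArtinLift M s σ) : IsArtinLift M s⁻¹ σ⁻¹ := by
  obtain ⟨e, γ, he, hγ⟩ := h
  refine ⟨e, γ⁻¹, fun x ↦ ?_, by rw [map_inv, map_inv, hγ]⟩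
  apply σ.injective
  rw [← he, ← AlgEquiv.mul_apply, ← map_mul, mul_inv_cancel, map_one, AlgEquiv.one_apply,
    ← AlgEquiv.mul_apply, mul_inv_cancel, AlgEquiv.one_apply]

/-- `IsArtinLift M s σ` depends on `s` only through `[s, M]`. [cite: Shimura1998, §18.3 p. 122] -/
theorem IsArtinLift.of_ideleArtinMap_eq (h : IsArtinLift M s σ) (hst : ideleArtinMap M s = ideleArtinMap M t) :
    IsArtinLift M t σ := by
  obtain ⟨e, γ, he, hγ⟩ := h
  exact ⟨e, γ, he, hγ.trans hst⟩

/-- The trivial idèle lifts the identity (restated from `isArtinLift_one_refl` with `1 : ℂ ≃ₐ[M] ℂ`).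
[cite: Shimura1998, §18.3 p. 122] -/
theorem isArtinLift_one_one : IsArtinLift M (1 : ideleGroup M) (1 : ℂ ≃ₐ[M] ℂ) :=
  isArtinLift_one_refl M

/-! ### Two lifts of one `σ` -/

/-- **«`c` is uniquely determined by `σ` independently of the choice of `y`»** — the Artin-symbol half:
two idèles lifting the same `σ ∈ Aut(ℂ/M)` have the same Artin symbol `[s, M] = [t, M]` (restrict both
witnesses along one embedding: they are then equal in `Gal(M̄/M)`, `e` being injective).
[cite: Shimura1998, §21.4, proof of Thm. 21.4, pp. 147–148] -/
theorem IsArtinLift.ideleArtinMap_eq (h₁ : IsArtinLift M s σ) (h₂ : IsArtinLift M t σ) :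
    ideleArtinMap M s = ideleArtinMap M t := by
  obtain ⟨e, γ, he, hγ⟩ := h₁
  obtain ⟨γ', he', hγ'⟩ := h₂.exists_of_embedding e
  have hγγ' : γ = γ' := by
    apply (toAlgEquiv M).injective
    ext x
    exact e.toRingHom.injective ((he x).trans (he' x).symm)
  rw [← hγ, ← hγ', hγγ']

/-- … equivalently `[s⁻¹t, M] = 1`: two lifts of one `σ` differ by an idèle in the kernel of the Artin
map (the closure of `M^× M_∞^×`, `NumberFields.ker_ideleArtinMap_eq_topologicalClosure_of_isTotallyComplex`).
[cite: Shimura1998, §21.4, proof of Thm. 21.4, pp. 147–148 («c = 1 if y belongs to the closure of k^× k_𝐚^×»)] -/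
theorem IsArtinLift.ideleArtinMap_inv_mul_eq_one (h₁ : IsArtinLift M s σ) (h₂ : IsArtinLift M t σ) :
    ideleArtinMap M (s⁻¹ * t) = 1 := by
  rw [map_mul, map_inv, h₁.ideleArtinMap_eq h₂, inv_mul_cancel]

/-- Conversely, a lift may be changed by any idèle with trivial Artin symbol.
[cite: Shimura1998, §21.4, proof of Thm. 21.4, pp. 147–148] -/
theorem IsArtinLift.mul_of_ideleArtinMap_eq_one (h : IsArtinLift M s σ) {z : ideleGroup M}
    (hz : ideleArtinMap M z = 1) : IsArtinLift M (s * z) σ :=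
  h.of_ideleArtinMap_eq (by rw [map_mul, hz, mul_one])


/-! ### Extending `γ ∈ Gal(M̄/M)` to `Aut(ℂ/M)`; `IsArtinLift` depends only on `σ|M̄`

(Appended 2026-08-28, seat A-p01, support (A2) for `stub_finiteLevelReciprocity` of line `a2b`: the action of
`Aut(ℂ/k)` on torsion points and the multiplier `c_σ` are read on the COMPACT group `Gal(k̄/k)`, which needs both
directions `Aut(ℂ/k) ⇄ Gal(k̄/k)` along a fixed embedding.) -/

section Extension

omit [Algebra M ℂ] in
/-- The algebraic closure of a number field is countable (an algebraic extension of an algebraic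
extension of the countable field `ℚ`; Mathlib `Algebra.IsAlgebraic.cardinalMk_le_max`); private plumbing. [folklore] -/
private theorem cardinalMk_algebraicClosure_le_aleph0 : Cardinal.mk (AlgebraicClosure M) ≤ Cardinal.aleph0 := by
  have hM : Cardinal.mk M ≤ Cardinal.aleph0 :=
    (Algebra.IsAlgebraic.cardinalMk_le_max ℚ M).trans (by simp)
  haveI : Algebra.IsAlgebraic M (AlgebraicClosure M) := AlgebraicClosure.isAlgebraic M
  exact (Algebra.IsAlgebraic.cardinalMk_le_max M (AlgebraicClosure M)).trans (max_le hM le_rfl)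

/-- **Every `γ ∈ Gal(M̄/M)` extends, along any `M`-embedding `e : M̄ → ℂ`, to an `M`-automorphism of `ℂ`**
(`M̄` is countable and `ℂ` is algebraically closed of cardinality `> ℵ₀`: the tree's
`FieldTheory.AlgClosed.exists_ringEquiv_apply_eq`, Lang *Algebra* VIII §1). [cite: Neukirch2013, Ch. IV §1] -/
theorem exists_algEquiv_apply_embedding_eq (e : AlgebraicClosure M →ₐ[M] ℂ) (γ : absoluteGaloisGroup M) :
    ∃ σ : ℂ ≃ₐ[M] ℂ, ∀ x : AlgebraicClosure M, σ (e x) = e (toAlgEquiv M γ x) := by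
  have hΩ : Cardinal.aleph0 < Cardinal.mk ℂ := by
    rw [Cardinal.mk_complex]; exact Cardinal.aleph0_lt_continuum
  obtain ⟨σ, hσ⟩ := Literature.FieldTheory.AlgClosed.exists_ringEquiv_apply_eq (Ω := ℂ)
    (F := AlgebraicClosure M) hΩ cardinalMk_algebraicClosure_le_aleph0 e.toRingHom
    (e.toRingHom.comp (toAlgEquiv M γ : AlgebraicClosure M →+* AlgebraicClosure M))
  have hfix : ∀ a : M, σ (algebraMap M ℂ a) = algebraMap M ℂ a := fun a ↦ by
    have h := hσ (algebraMap M (AlgebraicClosure M) a)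
    simp only [AlgHom.toRingHom_eq_coe, RingHom.coe_comp, RingHom.coe_coe, Function.comp_apply,
      AlgEquiv.commutes, AlgHom.commutes] at h
    exact h
  exact ⟨AlgEquiv.ofRingEquiv (f := σ) hfix, fun x ↦ hσ x⟩

/-- **`IsArtinLift M s σ` depends on `σ` only through its restriction to `M̄`**: if `σ, τ ∈ Aut(ℂ/M)` agree on
`e(M̄)` for one `M`-embedding `e`, then `σ = [s, M]` on `M_ab` iff `τ = [s, M]` on `M_ab`.
[cite: Shimura1998, §18.3 p. 122] -/
theorem IsArtinLift.of_forall_apply_embedding_eq (h : IsArtinLift M s σ) (e : AlgebraicClosure M →ₐ[M] ℂ)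
    (hστ : ∀ x : AlgebraicClosure M, σ (e x) = τ (e x)) : IsArtinLift M s τ := by
  obtain ⟨γ, he, hγ⟩ := h.exists_of_embedding e
  exact ⟨e, γ, fun x ↦ (he x).trans (hστ x), hγ⟩

/-- **Every `γ ∈ Gal(M̄/M)` is realised**: along a fixed `M`-embedding `e : M̄ → ℂ` there are
`σ ∈ Aut(ℂ/M)` extending `γ` and an idèle `s` with `σ = [s, M]` on `M_ab`, `[s, M] = γ|_{M^ab}`
(extension of automorphisms + surjectivity of the Artin map). [cite: Shimura1998, §18.3 p. 122] -/
theorem exists_algEquiv_isArtinLift_of_absoluteGaloisGroup (e : AlgebraicClosure M →ₐ[M] ℂ)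
    (γ : absoluteGaloisGroup M) :
    ∃ (σ : ℂ ≃ₐ[M] ℂ) (s : ideleGroup M), (∀ x : AlgebraicClosure M, σ (e x) = e (toAlgEquiv M γ x)) ∧
      IsArtinLift M s σ ∧ absGaloisAbProj M γ = ideleArtinMap M s := by
  obtain ⟨σ, hσ⟩ := exists_algEquiv_apply_embedding_eq e γ
  obtain ⟨s, hs⟩ := ideleArtinMap_surjective M (absGaloisAbProj M γ)
  exact ⟨σ, s, hσ, ⟨e, γ, fun x ↦ (hσ x).symm, hs.symm⟩, hs.symm⟩

/-- If `σ ∈ Aut(ℂ/M)` restricts along `e` to `γ` and `σ = [s, M]` on `M_ab`, then `[s, M] = γ|_{M^ab}`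
(the witness along `e` is unique). [cite: Shimura1998, §18.3 p. 122] -/
theorem IsArtinLift.absGaloisAbProj_eq_of_restricts (h : IsArtinLift M s σ) (e : AlgebraicClosure M →ₐ[M] ℂ)
    (γ : absoluteGaloisGroup M) (hσ : ∀ x : AlgebraicClosure M, σ (e x) = e (toAlgEquiv M γ x)) :
    absGaloisAbProj M γ = ideleArtinMap M s := by
  obtain ⟨γ', he', hγ'⟩ := h.exists_of_embedding e
  have hγγ' : γ = γ' := by
    apply (toAlgEquiv M).injective
    ext x
    exact e.toRingHom.injective ((hσ x).symm.trans (he' x).symm)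
  rw [hγγ', hγ']

end Extension

end Literature.NumberTheory.ComplexMultiplication

end
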